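/-
Copyright (c) 2026. All rights reserved.
Released under Apache 2.0 license as described in the file LICENSE.
-/
import Literature.MathematicalPhysics.QuantumFieldTheory.Balaban1983to89.B4Lemma22ReduceDeriv

/-!
# B4 pp. 579–581, (2.24)–(2.25)/(2.32) — THE SUP-NORM SMALLNESS OF THE PERTURBATION `V_k`: THREE OF ITS FOUR
PIECES, AND LEMMA 2.2 (2.17)_∞ FOR `G_k(□,Ã)` UP TO THE DIVERGENCE-FORM CROSS TERM

[B4] = T. Bałaban, *(Higgs)₂,₃ quantum fields in a finite volume. III. Regularity and decay of lattice Green's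
functions*, Commun. Math. Phys. **89** (1983) 571–597 (bib key `Balaban1983RegularityDecay`).

## The printed step («» = quotation units, transcript-B4.md ll. 133–137, 159–166)

p. 579–580 (2.24): «G_k^{1/2}(□,A₀)(−Δ^{η,N}_{A,□} + m_k² + a_kP_k(A))G_k^{1/2}(□,A₀) = I −
G_k^{1/2}(□,A₀)[F_{1,k}(−A')^*D^η_{A₀} + D^{η*}_{A₀}F_{1,k}(−A') − F_{1,k}(−A')^*F_{1,k}(−A')
− a_kF_{2,k}(A',A₀)^*Q_k(A₀) − a_kQ_k^*(A₀)F_{2,k}(A',A₀) − a_kF_{2,k}(A',A₀)^*F_{2,k}(A',A₀)]G_k^{1/2}(□,A₀)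
=: I − G_k^{1/2}(□,A₀)V_kG_k^{1/2}(□,A₀)», «where F_{1,k}(A) =
η^{−1}(U(A) − 1), (F_{2,k}(A',A₀)φ)(y) = Σ_{x∈B^k(y)} η^dF'_{1,k}(A'(Γ^{(k)}_{y,x}))U(A₀(Γ^{(k)}_{y,x}))φ(x), and
F'_{1,k}(A) = U(A) − 1. Taking into account the bound (2.23) …»; p. 581: «At first let us observe that V_k can be
interpreted as a first order differential operator acting on a function on the right hand side of it. The only
trouble is with the term D^{η*}_{A₀}F_{1,k}(−A'), for which it is not a natural interpretation. Using the formula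
(2.4) and the fact that A' has a compact support in □, we have (2.32) … Thus it is a first order differential operator
with small coefficients. Only here we needed the assumption that Ã is constant in a neighbourhood of ∂□.»

## What this file certifies (kernel form; the lineage's typed objects)

In the tree, `V = −vOp` with `vOp c a q W' W₀ T' T₀ = crossOp c W₀ E + (crossOp c W₀ E)ᵀ + quadOp c E +
a • (F₂ᵀQ₀ + Q₀ᵀF₂ + F₂ᵀF₂)` (`B4Lower18Regular.vOp`, `b4Op_add`; `E = pertE W' = 1 − U(κA')ᵀ`, `F₂ = pertF`,
`Q₀ = avgOp`), and `B4Lemma22ReduceZero.pertV` is this `V` on the fine box `Box d ℓ k M` with [B4]'s weights.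
* §2 computes the block kernels of the pieces: `(Cᵀu)(z) = Σ_y c(z,y)E(z,y)ᵀ(W₀(z,y)u(y) − u(z))`
  (`fld_crossOp_transpose_mulVec`) — a perturbation matrix times a COVARIANT BOND DIFFERENCE, i.e. the typed
  «F_{1,k}(−A')^*D^η_{A₀}»; `(Cu)(z) = Σ_x c(x,z)W₀(x,z)ᵀE(x,z)u(x) − Σ_y c(z,y)E(z,y)u(z)` (`fld_crossOp_mulVec`, the
  divergence-form term «D^{η*}_{A₀}F_{1,k}(−A')», NOT bounded here); `(F₁ᵀF₁u)(z) = Σ_y c(z,y)E(z,y)ᵀE(z,y)u(z)`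
  (`fld_quadOp_mulVec`).
* §3–§4: under the generator-Lipschitz hypothesis `hLip` of `B4Lemma22ReduceDeriv` (`|(U(t) − 1)v| ≤ ℓ|t||v|`), an
  antisymmetric background bond function `A₀` and nearest-neighbour smallness `|κA'_b| ≤ θ/n` (the lattice form of
  (2.23) «|A'|, |∂^η_μA'| ≤ c'e^{β−1}»), on the box `Π[0,N_μ)` with weights `boxWt` (`n²/2` per ordered
  nearest-neighbour pair):
  `firstOrderSmall_crossT : FirstOrderSmall supN Cᵀ (D^η_{A₀,μ})_μ ((d+1)ℓθ)` (the factor `n²` of the weights is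
  cancelled by `θ/n` and by the `1/n` of the bond difference `W₀(z,y)u(y) − u(z) = ±n^{-1}(D^η_{A₀,μ}u)(·)`,
  `bond_fwd`/`bond_bwd`/`bond_nbr_le`), and `firstOrderSmall_quad : FirstOrderSmall supN (F₁ᵀF₁) D ((d+1)ℓ²θ²)`
  (zeroth order).
* §5: on the fine box `Π[0,nM_μ)` over the unit lattice `Π[0,M_μ)` with block weights `blkWt` and transporters
  `U(κA(Γ_{y,x}))` (`contourTrans_fieldLink`), under the CONTOUR hypothesis `|κA'(Γ_{y,x})| ≤ τ` on the contours of each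
  block: `|Q₀u(y)| ≤ n^{d+1}‖u‖_∞`, `|F₂u(y)| ≤ n^{d+1}ℓτ‖u‖_∞`, `|Q₀ᵀw(x)| ≤ ‖w‖_∞`, `|F₂ᵀw(x)| ≤ ℓτ‖w‖_∞`, hence
  `aterm_supN_le' : ‖a_kn^{-(d+1)}(F₂ᵀQ₀ + Q₀ᵀF₂ + F₂ᵀF₂)u‖_∞ ≤ a_kℓτ(2 + ℓτ)‖u‖_∞` (zeroth order; [B4]'s coefficient
  of the averaging term is `a_kη^d·` with `η^d = n^{-(d+1)}` per fine point in lattice units, tree `greenA0`).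
* §6: `firstOrderSmall_vOp` / `firstOrderSmall_pertV`: IF the divergence-form cross term `C` is first-order small with
  constant `ε_C`, THEN `V` is, with `ε = ε_C + (d+1)ℓθ + (d+1)ℓ²θ² + a_kℓτ(2+ℓτ)`; and the headline
  `lemma22_17_sup_cross` = `B4Lemma22ReduceDeriv.lemma22_17_sup_field_regular` with its hypothesis
  `FirstOrderSmall supN pertV (derivA0 A₀) ε` replaced by the smallness of `C` alone plus the bond and contour
  hypotheses: (2.17)_∞, `n = 0,1`, both derivative conventions, for [B4]'s `G_k(□,Ã)` on a box.

## Honest scope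

(a) The cross term `C` («D^{η*}_{A₀}F_{1,k}(−A')») is NOT bounded here: its naive site bound carries a factor `n`; the
printed (2.32) regroups it by a summation by parts into `(∂^ηF_{1,k})·f + F_{1,k}·D^ηf`, which needs the DERIVATIVE
bound `|∂^η_μA'| ≤ c'e^{β−1}` of (2.23) (lattice form `|κ(A'(z,z+e_μ) − A'(z−e_μ,z))| ≤ θ/n²`) and «A' has a compact
support in □» (no partner bond at the faces) — the next node. (b) The contour hypothesis `|κA'(Γ_{y,x})| ≤ τ` is the
typed form of (2.23) summed along [B4]'s contours (length `≤ (d+1)n` bonds of size `θ/n`: `τ = (d+1)θ` for staircase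
contours, tree `B4Lower18Regular.abs_lsum_le`); it is kept abstract (any contour system). (c) Constants are explicit
and not optimised; `θ, τ` are free parameters (in [B4]: `O(e^βc₂)`). (d) Invertibility of `H(□,Ã)` stays a hypothesis
of the headline (tree `B4Lower18Regular.green_box_l2_bound`). No manuscript step is used as a hypothesis of a theorem
claiming a printed conclusion; 0 cited facts; every theorem is proved from the lineage's definitions.

v1.1 (DOCFIX, 2026-08-19; XREAD pv01-g16 D1/D2): the display (2.24) is printed on p. 579 (p. 580 opens with «where
F_{1,k} …») — loci of the decl tags corrected; «Ã is constant in a neighbourhood of ∂□» and the (2.23) size clause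
set as printed; no Lean statement or proof changed.
-/

namespace Literature.MathematicalPhysics.QuantumFieldTheory.Balaban1983to89.B4Lemma22PertVSup

open Finset Matrix
open Literature.MathematicalPhysics.QuantumFieldTheory.Balaban1983to89.B4GaugeCovariance (blockOp blockDiag fld
  fld_apply fld_blockOp_mulVec OrthFlow fieldLink IsGauge bondDiff siteP unitOp avgOp fld_avgOp_mulVec bondDiff_eq
  siteP_sandwich siteP_transpose_mul_siteP sum_unitOp_xy sum_unitOp_yx sum_unitOp_xx blockDiag_transpose blockOp_sub
  blockOp_transpose boxWt blkWt constBond contourTrans transport pathEnd sum_boxWt_right)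
open Literature.MathematicalPhysics.QuantumFieldTheory.Balaban1983to89.B4Lower18Regular (e1 kmul kmul_apply pertE
  pertT crossOp quadOp pertF vOp transport_fieldLink lsum sum_blkWt_row sum_blkWt_col)
open Literature.MathematicalPhysics.QuantumFieldTheory.Balaban1983to89.B4Lemma21Region (siteNorm covDeriv
  fld_covDeriv_mulVec_of_mem)
open Literature.MathematicalPhysics.QuantumFieldTheory.Balaban1983to89.B4Reflection242 (nbrs mem_nbrs boxDom
  card_nbrs)
open Literature.MathematicalPhysics.QuantumFieldTheory.Balaban1983to89.B4Lemma22Reduce231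
open Literature.MathematicalPhysics.QuantumFieldTheory.Balaban1983to89.B4Lemma22ReduceZero (siteNorm_sum_le)
open Literature.MathematicalPhysics.QuantumFieldTheory.Balaban1983to89.B4Lemma22ReduceDeriv (siteNorm_flow_sub_one_le
  siteNorm_flow add_e1_mem_nbrs)

noncomputable section

variable {ι : Type} [Fintype ι] [DecidableEq ι]

/-! ## §1 Norm helpers; first-order smallness is additive -/

omit [DecidableEq ι] in
/-- `|−v| = |v|`. [folklore] -/
theorem siteNorm_neg (v : ι → ℝ) : siteNorm (-v) = siteNorm v := by
  rw [← neg_one_smul ℝ v, siteNorm_smul, abs_neg, abs_one, one_mul]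

section General

variable {X : Type*} [Fintype X]

omit [DecidableEq ι] [Fintype X] in
/-- `‖−Φ‖_∞ = ‖Φ‖_∞`. [folklore] -/
theorem supN_neg (Φ : X × ι → ℝ) : supN (-Φ) = supN Φ := by
  unfold supN
  congr 1
  funext x
  exact siteNorm_neg (fld Φ x)

omit [DecidableEq ι] in
/-- `‖r • Φ‖_∞ ≤ |r|·‖Φ‖_∞`. [folklore] -/
theorem supN_smul_le (r : ℝ) (Φ : X × ι → ℝ) : supN (r • Φ) ≤ |r| * supN Φ :=
  supN_le (mul_nonneg (abs_nonneg r) (supN_nonneg Φ)) fun x => by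
    have : fld (r • Φ) x = r • fld Φ x := rfl
    rw [this, siteNorm_smul]
    exact mul_le_mul_of_nonneg_left (le_supN Φ x) (abs_nonneg r)

variable {K : Type*} [Fintype K]

omit [DecidableEq ι] in
/-- first-order smallness is ADDITIVE in the operator (for `ν = ‖·‖_∞`). [folklore] -/
theorem firstOrderSmall_add {V₁ V₂ : Matrix (X × ι) (X × ι) ℝ} {D : K → Matrix (X × ι) (X × ι) ℝ} {ε₁ ε₂ : ℝ}
    (h₁ : FirstOrderSmall supN V₁ D ε₁) (h₂ : FirstOrderSmall supN V₂ D ε₂) :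
    FirstOrderSmall supN (V₁ + V₂) D (ε₁ + ε₂) := by
  intro u
  rw [add_mulVec, add_mul]
  exact (supN_add_le _ _).trans (add_le_add (h₁ u) (h₂ u))

omit [DecidableEq ι] in
/-- first-order smallness of `−V`. [folklore] -/
theorem firstOrderSmall_neg {V : Matrix (X × ι) (X × ι) ℝ} {D : K → Matrix (X × ι) (X × ι) ℝ} {ε : ℝ}
    (h : FirstOrderSmall supN V D ε) : FirstOrderSmall supN (-V) D ε := by
  intro u
  rw [neg_mulVec, supN_neg]
  exact h u

omit [DecidableEq ι] in
/-- a ZEROTH-ORDER small operator is first-order small. [folklore] -/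
theorem firstOrderSmall_of_zeroth {V : Matrix (X × ι) (X × ι) ℝ} (D : K → Matrix (X × ι) (X × ι) ℝ) {ε : ℝ}
    (hε : 0 ≤ ε) (h : ∀ u, supN (V *ᵥ u) ≤ ε * supN u) : FirstOrderSmall supN V D ε := by
  intro u
  refine (h u).trans (mul_le_mul_of_nonneg_left ?_ hε)
  have : 0 ≤ ∑ μ, supN (D μ *ᵥ u) := sum_nonneg fun μ _ => supN_nonneg _
  linarith

omit [DecidableEq ι] in
/-- a PURELY FIRST-ORDER bound `‖Vu‖_∞ ≤ ε Σ_μ‖D_μu‖_∞` gives first-order smallness. [folklore] -/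
theorem firstOrderSmall_of_first {V : Matrix (X × ι) (X × ι) ℝ} {D : K → Matrix (X × ι) (X × ι) ℝ} {ε : ℝ}
    (hε : 0 ≤ ε) (h : ∀ u, supN (V *ᵥ u) ≤ ε * ∑ μ, supN (D μ *ᵥ u)) : FirstOrderSmall supN V D ε := by
  intro u
  refine (h u).trans (mul_le_mul_of_nonneg_left ?_ hε)
  linarith [supN_nonneg u]

omit [DecidableEq ι] in
/-- monotonicity in the constant. [folklore] -/
theorem firstOrderSmall_mono {V : Matrix (X × ι) (X × ι) ℝ} {D : K → Matrix (X × ι) (X × ι) ℝ} {ε ε' : ℝ}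
    (h : FirstOrderSmall supN V D ε) (hε : ε ≤ ε') : FirstOrderSmall supN V D ε' := by
  intro u
  refine (h u).trans (mul_le_mul_of_nonneg_right hε ?_)
  have : 0 ≤ ∑ μ, supN (D μ *ᵥ u) := sum_nonneg fun μ _ => supN_nonneg _
  linarith [supN_nonneg u]

/-! ## §2 The block kernels of the pieces of `vOp` ([B4] (2.24)) -/

variable [DecidableEq X]

/-- **THE CROSS TERM `C = Σ c·D_{W₀}ᵀEπ` AS A BLOCK OPERATOR** (divergence form: the adjoint bond difference acts on
the TEST side): kernel `C(z,z') = c(z',z)W₀(z',z)ᵀE(z',z) − 1[z=z']Σ_y c(z,y)E(z,y)`.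
[cite: Balaban1983RegularityDecay, p. 579 (2.24) «D^{η*}_{A₀}F_{1,k}(−A')»] -/
theorem crossOp_eq (c : X → X → ℝ) (W₀ E : X → X → Matrix ι ι ℝ) :
    crossOp c W₀ E
      = blockOp (fun z z' => c z' z • ((W₀ z' z)ᵀ * E z' z))
        - blockOp (fun z z' => if z = z' then ∑ y, c z y • E z y else 0) := by
  have hterm : ∀ x y, (bondDiff W₀ x y)ᵀ * (blockDiag (fun _ : Unit => E x y) * siteP (ι := ι) x)
      = unitOp y x ((W₀ x y)ᵀ * E x y) - unitOp x x (E x y) := by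
    intro x y
    rw [bondDiff_eq, Matrix.transpose_sub, Matrix.transpose_mul, B4GaugeCovariance.blockDiag_transpose,
      Matrix.sub_mul, siteP_sandwich, ← Matrix.mul_assoc, siteP_transpose_mul_siteP]
  simp only [crossOp, hterm, smul_sub, Finset.sum_sub_distrib]
  rw [sum_unitOp_yx c (fun x y => (W₀ x y)ᵀ * E x y), sum_unitOp_xx c E]

/-- **THE ADJOINT CROSS TERM `Cᵀ = Σ c·(Eπ)ᵀD_{W₀}`** (the bond difference acts on the FIELD side): kernel
`Cᵀ(z,z') = c(z,z')E(z,z')ᵀW₀(z,z') − 1[z=z']Σ_y c(z,y)E(z,y)ᵀ`.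
[cite: Balaban1983RegularityDecay, p. 579 (2.24) «F_{1,k}(−A')^*D^η_{A₀}»] -/
theorem crossOp_transpose_eq (c : X → X → ℝ) (W₀ E : X → X → Matrix ι ι ℝ) :
    (crossOp c W₀ E)ᵀ
      = blockOp (fun z z' => c z z' • ((E z z')ᵀ * W₀ z z'))
        - blockOp (fun z z' => if z = z' then ∑ y, c z y • (E z y)ᵀ else 0) := by
  have hterm : ∀ x y, ((bondDiff W₀ x y)ᵀ * (blockDiag (fun _ : Unit => E x y) * siteP (ι := ι) x))ᵀ
      = unitOp x y ((E x y)ᵀ * W₀ x y) - unitOp x x (E x y)ᵀ := by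
    intro x y
    rw [Matrix.transpose_mul, Matrix.transpose_transpose, Matrix.transpose_mul,
      B4GaugeCovariance.blockDiag_transpose, bondDiff_eq, Matrix.mul_sub, siteP_sandwich,
      siteP_transpose_mul_siteP]
  simp only [crossOp, Matrix.transpose_sum, Matrix.transpose_smul, hterm, smul_sub, Finset.sum_sub_distrib]
  rw [sum_unitOp_xy c (fun x y => (E x y)ᵀ * W₀ x y), sum_unitOp_xx c (fun x y => (E x y)ᵀ)]

/-- **THE QUADRATIC TERM `F₁^*F₁ = Σ c·(Eπ)ᵀ(Eπ)`** is block diagonal: `1[z=z']Σ_y c(z,y)E(z,y)ᵀE(z,y)`.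
[cite: Balaban1983RegularityDecay, p. 579 (2.24) «F_{1,k}(−A')^*F_{1,k}(−A')»] -/
theorem quadOp_eq (c : X → X → ℝ) (E : X → X → Matrix ι ι ℝ) :
    quadOp c E = blockOp (fun z z' => if z = z' then ∑ y, c z y • ((E z y)ᵀ * E z y) else 0) := by
  have hterm : ∀ x y, (blockDiag (fun _ : Unit => E x y) * siteP (ι := ι) x)ᵀ
      * (blockDiag (fun _ : Unit => E x y) * siteP (ι := ι) x) = unitOp x x ((E x y)ᵀ * E x y) := by
    intro x y
    rw [Matrix.transpose_mul, B4GaugeCovariance.blockDiag_transpose, siteP_sandwich]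
  simp only [quadOp, hterm]
  rw [sum_unitOp_xx c (fun x y => (E x y)ᵀ * E x y)]

omit [DecidableEq ι] in
/-- the diagonal block operator acts sitewise. [folklore] -/
theorem fld_blockOp_diag_mulVec (g : X → Matrix ι ι ℝ) (u : X × ι → ℝ) (z : X) :
    fld (blockOp (fun z z' => if z = z' then g z else 0) *ᵥ u) z = g z *ᵥ fld u z := by
  rw [fld_blockOp_mulVec, Finset.sum_eq_single z]
  · rw [if_pos rfl]
  · intro z' _ hz'
    rw [if_neg (Ne.symm hz'), zero_mulVec]
  · intro h; exact absurd (Finset.mem_univ z) h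

/-- **`(Cᵀu)(z) = Σ_y c(z,y)·E(z,y)ᵀ(W₀(z,y)u(y) − u(z))`** — the adjoint cross term is `E ×` the covariant bond
differences of `u`. [cite: Balaban1983RegularityDecay, p. 579 (2.24)] -/
theorem fld_crossOp_transpose_mulVec (c : X → X → ℝ) (W₀ E : X → X → Matrix ι ι ℝ) (u : X × ι → ℝ) (z : X) :
    fld ((crossOp c W₀ E)ᵀ *ᵥ u) z = ∑ y, c z y • ((E z y)ᵀ *ᵥ (W₀ z y *ᵥ fld u y - fld u z)) := by
  rw [crossOp_transpose_eq, sub_mulVec, B4Lemma22ReduceDeriv.fld_sub, fld_blockOp_mulVec,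
    fld_blockOp_diag_mulVec, sum_mulVec]
  rw [← Finset.sum_sub_distrib]
  refine Finset.sum_congr rfl fun y _ => ?_
  rw [smul_mulVec, smul_mulVec, ← mulVec_mulVec, mulVec_sub, smul_sub]

/-- **`(Cu)(z) = Σ_x c(x,z)·W₀(x,z)ᵀE(x,z)u(x) − Σ_y c(z,y)E(z,y)u(z)`** — the cross term proper, in divergence
form. [cite: Balaban1983RegularityDecay, p. 579 (2.24)] -/
theorem fld_crossOp_mulVec (c : X → X → ℝ) (W₀ E : X → X → Matrix ι ι ℝ) (u : X × ι → ℝ) (z : X) :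
    fld (crossOp c W₀ E *ᵥ u) z
      = ∑ x, c x z • (((W₀ x z)ᵀ * E x z) *ᵥ fld u x) - ∑ y, c z y • (E z y *ᵥ fld u z) := by
  rw [crossOp_eq, sub_mulVec, B4Lemma22ReduceDeriv.fld_sub, fld_blockOp_mulVec, fld_blockOp_diag_mulVec,
    sum_mulVec]
  simp only [smul_mulVec]

/-- **`(F₁^*F₁u)(z) = Σ_y c(z,y)·E(z,y)ᵀE(z,y)u(z)`**. [cite: Balaban1983RegularityDecay, p. 579 (2.24)] -/
theorem fld_quadOp_mulVec (c : X → X → ℝ) (E : X → X → Matrix ι ι ℝ) (u : X × ι → ℝ) (z : X) :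
    fld (quadOp c E *ᵥ u) z = ∑ y, c z y • ((E z y)ᵀ *ᵥ (E z y *ᵥ fld u z)) := by
  rw [quadOp_eq, fld_blockOp_diag_mulVec, sum_mulVec]
  simp only [smul_mulVec, mulVec_mulVec]

/-! ## §3 Site bounds for the perturbation matrix `E = 1 − U(κA')ᵀ` -/

omit [Fintype X] [DecidableEq X] in
/-- **`|E(x,y)v| ≤ ℓ|κA'(x,y)|·|v|`** (`E = 1 − U(κA')ᵀ = −(U(−κA') − 1)`).
[cite: Balaban1983RegularityDecay, p. 580] -/
theorem pertE_mulVec_le (F : OrthFlow ι) {ℓ : ℝ} (hℓ : 0 ≤ ℓ)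
    (hLip : ∀ t (v : ι → ℝ), ((F.U t - 1) *ᵥ v) ⬝ᵥ ((F.U t - 1) *ᵥ v) ≤ (ℓ * t) ^ 2 * (v ⬝ᵥ v))
    (κ : ℝ) (A' : X → X → ℝ) (x y : X) (v : ι → ℝ) :
    siteNorm (pertE (fieldLink F κ A') x y *ᵥ v) ≤ ℓ * |κ * A' x y| * siteNorm v := by
  have h : pertE (fieldLink F κ A') x y = -(F.U (-(κ * A' x y)) - 1) := by
    simp only [pertE, fieldLink, F.transpose_eq, neg_sub]
  rw [h, neg_mulVec, siteNorm_neg]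
  simpa only [abs_neg] using siteNorm_flow_sub_one_le F hℓ hLip (-(κ * A' x y)) v

omit [Fintype X] [DecidableEq X] in
/-- **`|E(x,y)ᵀv| ≤ ℓ|κA'(x,y)|·|v|`** (`Eᵀ = 1 − U(κA')`). [cite: Balaban1983RegularityDecay, p. 580] -/
theorem pertE_transpose_mulVec_le (F : OrthFlow ι) {ℓ : ℝ} (hℓ : 0 ≤ ℓ)
    (hLip : ∀ t (v : ι → ℝ), ((F.U t - 1) *ᵥ v) ⬝ᵥ ((F.U t - 1) *ᵥ v) ≤ (ℓ * t) ^ 2 * (v ⬝ᵥ v))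
    (κ : ℝ) (A' : X → X → ℝ) (x y : X) (v : ι → ℝ) :
    siteNorm ((pertE (fieldLink F κ A') x y)ᵀ *ᵥ v) ≤ ℓ * |κ * A' x y| * siteNorm v := by
  have h : (pertE (fieldLink F κ A') x y)ᵀ = -(F.U (κ * A' x y) - 1) := by
    simp only [pertE, fieldLink, Matrix.transpose_sub, Matrix.transpose_one, Matrix.transpose_transpose, neg_sub]
  rw [h, neg_mulVec, siteNorm_neg]
  exact siteNorm_flow_sub_one_le F hℓ hLip (κ * A' x y) v

end General

/-! ## §4 The field-side cross term `Cᵀ` and the quadratic term on a box: first- and zeroth-order small -/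

section Box

variable {d : ℕ}

omit [Fintype ι] [DecidableEq ι] in
/-- the constant background is an antisymmetric bond function. [folklore] -/
theorem constBond_antisymm {X : Type*} (A₀ : Fin (d + 1) → ℝ) (pos : X → Fin (d + 1) → ℤ) (x y : X) :
    constBond A₀ pos y x = -constBond A₀ pos x y := by
  simp only [constBond, ← Finset.sum_neg_distrib]
  exact Finset.sum_congr rfl fun μ _ => by ring

/-- `U(κA₀(x,y))U(κA₀(y,x)) = 1` for an antisymmetric bond function. [folklore] -/
theorem fieldLink_mul_rev {X : Type*} (F : OrthFlow ι) (κ : ℝ) (A₀ : X → X → ℝ) (hanti : ∀ x y, A₀ y x = -A₀ x y)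
    (x y : X) : fieldLink F κ A₀ x y * fieldLink F κ A₀ y x = 1 := by
  simp only [fieldLink]
  rw [← F.map_add, hanti, mul_neg, neg_add_cancel, F.map_zero]

/-- the bond weights are nonnegative. [folklore] -/
theorem boxWt_nonneg (n : ℕ) (N : Fin (d + 1) → ℕ) (x y : ↥(boxDom N)) : 0 ≤ boxWt n N x y := by
  unfold boxWt
  split_ifs <;> positivity

/-- **FORWARD BOND**: `W₀(z, z+e_μ)u(z+e_μ) − u(z) = η·(D^η_{W₀,μ}u)(z)`.
[cite: Balaban1983RegularityDecay, p. 572 (1.3)] -/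
theorem bond_fwd {n : ℕ} (hn : 1 ≤ n) {R : Finset (Fin (d + 1) → ℤ)} (W₀ : ↥R → ↥R → Matrix ι ι ℝ)
    (μ : Fin (d + 1)) (u : ↥R × ι → ℝ) {z y : ↥R} (hy : y.1 = z.1 + e1 μ) :
    W₀ z y *ᵥ fld u y - fld u z = ((n : ℝ)⁻¹) • fld (covDeriv n R W₀ μ *ᵥ u) z := by
  have hn0 : (n : ℝ) ≠ 0 := by positivity
  have h : z.1 + e1 μ ∈ R := hy ▸ y.2
  have hy' : y = ⟨z.1 + e1 μ, h⟩ := Subtype.ext hy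
  subst hy'
  rw [fld_covDeriv_mulVec_of_mem n W₀ u h, smul_smul, inv_mul_cancel₀ hn0, one_smul]

/-- **BACKWARD BOND**: `W₀(z, z−e_μ)u(z−e_μ) − u(z) = −W₀(z, z−e_μ)·η·(D^η_{W₀,μ}u)(z−e_μ)` (orthogonal links of an
antisymmetric bond function). [cite: Balaban1983RegularityDecay, p. 572 (1.3)] -/
theorem bond_bwd (F : OrthFlow ι) (κ : ℝ) {n : ℕ} (hn : 1 ≤ n) {R : Finset (Fin (d + 1) → ℤ)} (A₀ : ↥R → ↥R → ℝ)
    (hanti : ∀ x y, A₀ y x = -A₀ x y) (μ : Fin (d + 1)) (u : ↥R × ι → ℝ) {z y : ↥R} (hz : z.1 = y.1 + e1 μ) :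
    fieldLink F κ A₀ z y *ᵥ fld u y - fld u z
      = -(fieldLink F κ A₀ z y *ᵥ (((n : ℝ)⁻¹) • fld (covDeriv n R (fieldLink F κ A₀) μ *ᵥ u) y)) := by
  have hn0 : (n : ℝ) ≠ 0 := by positivity
  have h : y.1 + e1 μ ∈ R := hz ▸ z.2
  have hz' : z = ⟨y.1 + e1 μ, h⟩ := Subtype.ext hz
  subst hz'
  rw [fld_covDeriv_mulVec_of_mem n _ u h, smul_smul, inv_mul_cancel₀ hn0, one_smul, mulVec_sub, mulVec_mulVec,
    fieldLink_mul_rev F κ A₀ hanti, one_mulVec, neg_sub]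

/-- **THE COVARIANT BOND DIFFERENCE ACROSS A NEAREST-NEIGHBOUR BOND IS `η ×` A COVARIANT DERIVATIVE**:
`|W₀(z,y)u(y) − u(z)| ≤ η·Σ_μ‖D^η_{W₀,μ}u‖_∞` for `y ∈ nbrs z` inside the region.
[cite: Balaban1983RegularityDecay, p. 572 (1.3)] -/
theorem bond_nbr_le (F : OrthFlow ι) (κ : ℝ) {n : ℕ} (hn : 1 ≤ n) {R : Finset (Fin (d + 1) → ℤ)}
    (A₀ : ↥R → ↥R → ℝ) (hanti : ∀ x y, A₀ y x = -A₀ x y) (u : ↥R × ι → ℝ) {z y : ↥R} (hy : y.1 ∈ nbrs z.1) :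
    siteNorm (fieldLink F κ A₀ z y *ᵥ fld u y - fld u z)
      ≤ (n : ℝ)⁻¹ * ∑ μ, supN (covDeriv n R (fieldLink F κ A₀) μ *ᵥ u) := by
  have hn0 : (0 : ℝ) < n := by exact_mod_cast hn
  have hS : ∀ μ (x : ↥R), siteNorm (fld (covDeriv n R (fieldLink F κ A₀) μ *ᵥ u) x)
      ≤ ∑ μ, supN (covDeriv n R (fieldLink F κ A₀) μ *ᵥ u) := fun μ x =>
    (le_supN _ x).trans (single_le_sum (f := fun μ => supN (covDeriv n R (fieldLink F κ A₀) μ *ᵥ u))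
      (fun μ _ => supN_nonneg _) (mem_univ μ))
  obtain ⟨μ, hμ | hμ⟩ := mem_nbrs.1 hy
  · rw [bond_fwd hn (fieldLink F κ A₀) μ u hμ, siteNorm_smul, abs_of_nonneg (inv_nonneg.2 hn0.le)]
    exact mul_le_mul_of_nonneg_left (hS μ z) (inv_nonneg.2 hn0.le)
  · have hz : z.1 = y.1 + e1 μ := by rw [hμ, e1, sub_add_cancel]
    rw [bond_bwd F κ hn A₀ hanti μ u hz, siteNorm_neg]
    have : siteNorm (fieldLink F κ A₀ z y *ᵥ (((n : ℝ)⁻¹) • fld (covDeriv n R (fieldLink F κ A₀) μ *ᵥ u) y))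
        = siteNorm ((((n : ℝ)⁻¹) • fld (covDeriv n R (fieldLink F κ A₀) μ *ᵥ u) y)) := siteNorm_flow F _ _
    rw [this, siteNorm_smul, abs_of_nonneg (inv_nonneg.2 hn0.le)]
    exact mul_le_mul_of_nonneg_left (hS μ y) (inv_nonneg.2 hn0.le)

/-- at most `2(d+1)` neighbours lie in the box. [folklore] -/
theorem card_nbrs_filter_le (N : Fin (d + 1) → ℕ) (z : ↥(boxDom N)) :
    (((nbrs z.1).filter fun w => w ∈ boxDom N).card : ℝ) ≤ 2 * ((d : ℝ) + 1) := by
  have h : ((nbrs z.1).filter fun w => w ∈ boxDom N).card ≤ 2 * (d + 1) := by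
    rw [← card_nbrs z.1]
    exact Finset.card_filter_le _ _
  exact_mod_cast h

/-- **THE FIELD-SIDE CROSS TERM IS FIRST-ORDER SMALL, SITEWISE**: under `|κA'_b| ≤ θ/n` on nearest-neighbour bonds,
`|(Cᵀu)(z)| ≤ (d+1)ℓθ·Σ_μ‖D^η_{A₀,μ}u‖_∞` — the bond weight `η^{-2}/2`, the factor `η` of `E = −ηF₁` and the factor
`η` of the bond difference compensate exactly. [cite: Balaban1983RegularityDecay, p. 581 (2.32)] -/
theorem crossT_site (F : OrthFlow ι) {ℓ : ℝ} (hℓ : 0 ≤ ℓ)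
    (hLip : ∀ t (v : ι → ℝ), ((F.U t - 1) *ᵥ v) ⬝ᵥ ((F.U t - 1) *ᵥ v) ≤ (ℓ * t) ^ 2 * (v ⬝ᵥ v))
    (κ : ℝ) {n : ℕ} (hn : 1 ≤ n) (N : Fin (d + 1) → ℕ) (A₀ : ↥(boxDom N) → ↥(boxDom N) → ℝ)
    (hanti : ∀ x y, A₀ y x = -A₀ x y) {A' : ↥(boxDom N) → ↥(boxDom N) → ℝ} {θ : ℝ} (hθ : 0 ≤ θ)
    (hA' : ∀ x y, y.1 ∈ nbrs x.1 → |κ * A' x y| ≤ θ / n) (u : ↥(boxDom N) × ι → ℝ) (z : ↥(boxDom N)) :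
    siteNorm (fld ((crossOp (boxWt n N) (fieldLink F κ A₀) (pertE (fieldLink F κ A')))ᵀ *ᵥ u) z)
      ≤ ((d : ℝ) + 1) * ℓ * θ * ∑ μ, supN (covDeriv n (boxDom N) (fieldLink F κ A₀) μ *ᵥ u) := by
  have hn0 : (0 : ℝ) < n := by exact_mod_cast hn
  set S := ∑ μ, supN (covDeriv n (boxDom N) (fieldLink F κ A₀) μ *ᵥ u) with hSdef
  have hS0 : 0 ≤ S := sum_nonneg fun μ _ => supN_nonneg _
  rw [fld_crossOp_transpose_mulVec]
  refine (siteNorm_sum_le _ _).trans ?_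
  have hterm : ∀ y, siteNorm (boxWt n N z y • ((pertE (fieldLink F κ A') z y)ᵀ
      *ᵥ (fieldLink F κ A₀ z y *ᵥ fld u y - fld u z))) ≤ boxWt n N z y * (ℓ * (θ / n) * ((n : ℝ)⁻¹ * S)) := by
    intro y
    rw [siteNorm_smul, abs_of_nonneg (boxWt_nonneg n N z y)]
    by_cases hy : y.1 ∈ nbrs z.1
    · refine mul_le_mul_of_nonneg_left ?_ (boxWt_nonneg n N z y)
      refine (pertE_transpose_mulVec_le F hℓ hLip κ A' z y _).trans ?_
      exact mul_le_mul (mul_le_mul_of_nonneg_left (hA' z y hy) hℓ) (bond_nbr_le F κ hn A₀ hanti u hy)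
        (siteNorm_nonneg _) (mul_nonneg hℓ (div_nonneg hθ hn0.le))
    · simp [boxWt, hy]
  refine (sum_le_sum fun y _ => hterm y).trans ?_
  rw [← sum_mul, sum_boxWt_right]
  have h0 : 0 ≤ ℓ * (θ / n) * ((n : ℝ)⁻¹ * S) := by positivity
  calc (n : ℝ) ^ 2 / 2 * (((nbrs z.1).filter fun w => w ∈ boxDom N).card : ℝ) * (ℓ * (θ / n) * ((n : ℝ)⁻¹ * S))
      ≤ (n : ℝ) ^ 2 / 2 * (2 * ((d : ℝ) + 1)) * (ℓ * (θ / n) * ((n : ℝ)⁻¹ * S)) :=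
        mul_le_mul_of_nonneg_right (mul_le_mul_of_nonneg_left (card_nbrs_filter_le N z) (by positivity)) h0
    _ = ((d : ℝ) + 1) * ℓ * θ * S := by field_simp

/-- **`‖Cᵀu‖_∞ ≤ (d+1)ℓθ·Σ_μ‖D^η_{A₀,μ}u‖_∞`**; the field-side cross term of `V` is FIRST-ORDER SMALL with constant
`(d+1)ℓθ` relative to `(D^η_{A₀,μ})_μ`. [cite: Balaban1983RegularityDecay, p. 581 (2.32)] -/
theorem firstOrderSmall_crossT (F : OrthFlow ι) {ℓ : ℝ} (hℓ : 0 ≤ ℓ)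
    (hLip : ∀ t (v : ι → ℝ), ((F.U t - 1) *ᵥ v) ⬝ᵥ ((F.U t - 1) *ᵥ v) ≤ (ℓ * t) ^ 2 * (v ⬝ᵥ v))
    (κ : ℝ) {n : ℕ} (hn : 1 ≤ n) (N : Fin (d + 1) → ℕ) (A₀ : ↥(boxDom N) → ↥(boxDom N) → ℝ)
    (hanti : ∀ x y, A₀ y x = -A₀ x y) {A' : ↥(boxDom N) → ↥(boxDom N) → ℝ} {θ : ℝ} (hθ : 0 ≤ θ)
    (hA' : ∀ x y, y.1 ∈ nbrs x.1 → |κ * A' x y| ≤ θ / n) :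
    FirstOrderSmall supN (crossOp (boxWt n N) (fieldLink F κ A₀) (pertE (fieldLink F κ A')))ᵀ
      (covDeriv n (boxDom N) (fieldLink F κ A₀)) (((d : ℝ) + 1) * ℓ * θ) :=
  firstOrderSmall_of_first (by positivity) fun u =>
    supN_le (mul_nonneg (by positivity) (sum_nonneg fun μ _ => supN_nonneg _))
      fun z => crossT_site F hℓ hLip κ hn N A₀ hanti hθ hA' u z

/-- **THE QUADRATIC TERM IS ZEROTH-ORDER SMALL, SITEWISE**: `|(F₁^*F₁u)(z)| ≤ (d+1)ℓ²θ²‖u‖_∞`.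
[cite: Balaban1983RegularityDecay, p. 581 (2.32)] -/
theorem quad_site (F : OrthFlow ι) {ℓ : ℝ} (hℓ : 0 ≤ ℓ)
    (hLip : ∀ t (v : ι → ℝ), ((F.U t - 1) *ᵥ v) ⬝ᵥ ((F.U t - 1) *ᵥ v) ≤ (ℓ * t) ^ 2 * (v ⬝ᵥ v))
    (κ : ℝ) {n : ℕ} (hn : 1 ≤ n) (N : Fin (d + 1) → ℕ) {A' : ↥(boxDom N) → ↥(boxDom N) → ℝ} {θ : ℝ}
    (hθ : 0 ≤ θ) (hA' : ∀ x y, y.1 ∈ nbrs x.1 → |κ * A' x y| ≤ θ / n) (u : ↥(boxDom N) × ι → ℝ)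
    (z : ↥(boxDom N)) :
    siteNorm (fld (quadOp (boxWt n N) (pertE (fieldLink F κ A')) *ᵥ u) z)
      ≤ ((d : ℝ) + 1) * ℓ ^ 2 * θ ^ 2 * supN u := by
  have hn0 : (0 : ℝ) < n := by exact_mod_cast hn
  rw [fld_quadOp_mulVec]
  refine (siteNorm_sum_le _ _).trans ?_
  have hterm : ∀ y, siteNorm (boxWt n N z y • ((pertE (fieldLink F κ A') z y)ᵀ
      *ᵥ (pertE (fieldLink F κ A') z y *ᵥ fld u z))) ≤ boxWt n N z y * ((ℓ * (θ / n)) ^ 2 * supN u) := by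
    intro y
    rw [siteNorm_smul, abs_of_nonneg (boxWt_nonneg n N z y)]
    by_cases hy : y.1 ∈ nbrs z.1
    · refine mul_le_mul_of_nonneg_left ?_ (boxWt_nonneg n N z y)
      have h1 := hA' z y hy
      have h2 : ℓ * |κ * A' z y| ≤ ℓ * (θ / n) := mul_le_mul_of_nonneg_left h1 hℓ
      have h3 : 0 ≤ ℓ * (θ / n) := mul_nonneg hℓ (div_nonneg hθ hn0.le)
      calc siteNorm ((pertE (fieldLink F κ A') z y)ᵀ *ᵥ (pertE (fieldLink F κ A') z y *ᵥ fld u z))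
          ≤ ℓ * |κ * A' z y| * siteNorm (pertE (fieldLink F κ A') z y *ᵥ fld u z) :=
            pertE_transpose_mulVec_le F hℓ hLip κ A' z y _
        _ ≤ ℓ * (θ / n) * (ℓ * (θ / n) * supN u) := by
            refine mul_le_mul h2 ?_ (siteNorm_nonneg _) h3
            exact (pertE_mulVec_le F hℓ hLip κ A' z y _).trans
              (mul_le_mul h2 (le_supN u z) (siteNorm_nonneg _) h3)
        _ = (ℓ * (θ / n)) ^ 2 * supN u := by ring
    · simp [boxWt, hy]
  refine (sum_le_sum fun y _ => hterm y).trans ?_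
  rw [← sum_mul, sum_boxWt_right]
  have h0 : 0 ≤ (ℓ * (θ / n)) ^ 2 * supN u := mul_nonneg (sq_nonneg _) (supN_nonneg u)
  calc (n : ℝ) ^ 2 / 2 * (((nbrs z.1).filter fun w => w ∈ boxDom N).card : ℝ) * ((ℓ * (θ / n)) ^ 2 * supN u)
      ≤ (n : ℝ) ^ 2 / 2 * (2 * ((d : ℝ) + 1)) * ((ℓ * (θ / n)) ^ 2 * supN u) :=
        mul_le_mul_of_nonneg_right (mul_le_mul_of_nonneg_left (card_nbrs_filter_le N z) (by positivity)) h0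
    _ = ((d : ℝ) + 1) * ℓ ^ 2 * θ ^ 2 * supN u := by field_simp

/-- **`‖F₁^*F₁u‖_∞ ≤ (d+1)ℓ²θ²‖u‖_∞`**: the quadratic term of `V` is (zeroth- hence) first-order small with constant
`(d+1)ℓ²θ²`. [cite: Balaban1983RegularityDecay, p. 581 (2.32)] -/
theorem firstOrderSmall_quad (F : OrthFlow ι) {ℓ : ℝ} (hℓ : 0 ≤ ℓ)
    (hLip : ∀ t (v : ι → ℝ), ((F.U t - 1) *ᵥ v) ⬝ᵥ ((F.U t - 1) *ᵥ v) ≤ (ℓ * t) ^ 2 * (v ⬝ᵥ v))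
    (κ : ℝ) {n : ℕ} (hn : 1 ≤ n) (N : Fin (d + 1) → ℕ) {A' : ↥(boxDom N) → ↥(boxDom N) → ℝ} {θ : ℝ}
    (hθ : 0 ≤ θ) (hA' : ∀ x y, y.1 ∈ nbrs x.1 → |κ * A' x y| ≤ θ / n)
    {K : Type*} [Fintype K] (D : K → Matrix (↥(boxDom N) × ι) (↥(boxDom N) × ι) ℝ) :
    FirstOrderSmall supN (quadOp (boxWt n N) (pertE (fieldLink F κ A'))) D (((d : ℝ) + 1) * ℓ ^ 2 * θ ^ 2) :=
  firstOrderSmall_of_zeroth D (by positivity) fun u =>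
    supN_le (mul_nonneg (by positivity) (supN_nonneg u)) fun z => quad_site F hℓ hLip κ hn N hθ hA' u z

end Box

/-! ## §5 The `a`-terms `a_k(F₂^*Q_k(A₀) + Q_k^*(A₀)F₂ + F₂^*F₂)` on a box: zeroth-order small -/

section ATerms

variable {d : ℕ}

/-- the block weights are nonnegative. [folklore] -/
theorem blkWt_nonneg (n : ℕ) (M N : Fin (d + 1) → ℕ) (y : ↥(boxDom M)) (x : ↥(boxDom N)) :
    0 ≤ blkWt n M N y x := by
  unfold blkWt
  split_ifs <;> norm_num

/-- the transporters of the abelian flow are values of the flow: `U(κA(Γ_{y,x}))`.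
[cite: Balaban1983RegularityDecay, p. 572 (1.4)] -/
theorem contourTrans_fieldLink {X Y : Type*} (F : OrthFlow ι) (κ : ℝ) (B : X → X → ℝ) (emb : Y → X)
    (Γ : Y → X → List X) (y : Y) (x : X) :
    contourTrans (fieldLink F κ B) emb Γ y x = F.U (κ * lsum B (emb y) (Γ y x)) :=
  transport_fieldLink F κ B (emb y) (Γ y x)

omit [DecidableEq ι] in
/-- the adjoint averaging operator acts by `(Qᵀw)(x) = Σ_y q(y,x)T(y,x)ᵀw(y)`. [folklore] -/
theorem fld_avgOp_transpose_mulVec {X Y : Type*} [Fintype Y] (q : Y → X → ℝ) (T : Y → X → Matrix ι ι ℝ)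
    (w : Y × ι → ℝ) (x : X) : fld ((avgOp q T)ᵀ *ᵥ w) x = ∑ y, q y x • ((T y x)ᵀ *ᵥ fld w y) := by
  rw [avgOp, blockOp_transpose, fld_blockOp_mulVec]
  simp only [Matrix.transpose_smul, smul_mulVec]

variable (F : OrthFlow ι) {ℓ : ℝ} (κ : ℝ) {n : ℕ} (M : Fin (d + 1) → ℕ)
  (emb : ↥(boxDom M) → ↥(boxDom fun i => n * M i))
  (Γ : ↥(boxDom M) → ↥(boxDom fun i => n * M i) → List ↥(boxDom fun i => n * M i))
  (A₀ A' : ↥(boxDom fun i => n * M i) → ↥(boxDom fun i => n * M i) → ℝ) {τ : ℝ}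

/-- **`|(Q_k(A₀)u)(y)| ≤ n^{d+1}‖u‖_∞`** (a unit block holds `n^{d+1}` fine points; transporters are orthogonal).
[cite: Balaban1983RegularityDecay, p. 572 (1.4)] -/
theorem avg_site (hn : 1 ≤ n) (u : ↥(boxDom fun i => n * M i) × ι → ℝ) (y : ↥(boxDom M)) :
    siteNorm (fld (avgOp (blkWt n M fun i => n * M i) (contourTrans (fieldLink F κ A₀) emb Γ) *ᵥ u) y)
      ≤ (n : ℝ) ^ (d + 1) * supN u := by
  rw [fld_avgOp_mulVec]
  refine (siteNorm_sum_le _ _).trans ?_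
  have hterm : ∀ x, siteNorm (blkWt n M (fun i => n * M i) y x
      • (contourTrans (fieldLink F κ A₀) emb Γ y x *ᵥ fld u x)) ≤ blkWt n M (fun i => n * M i) y x * supN u := by
    intro x
    rw [siteNorm_smul, abs_of_nonneg (blkWt_nonneg n M _ y x), contourTrans_fieldLink, siteNorm_flow]
    exact mul_le_mul_of_nonneg_left (le_supN u x) (blkWt_nonneg n M _ y x)
  refine (sum_le_sum fun x _ => hterm x).trans ?_
  rw [← sum_mul]
  exact mul_le_mul_of_nonneg_right (sum_blkWt_row hn M y) (supN_nonneg u)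

/-- **`|(F₂u)(y)| ≤ n^{d+1}ℓτ‖u‖_∞`** under `|κA'(Γ_{y,x})| ≤ τ` on the contours of the block of `y` ([B4] p. 580
«F'_{1,k}(A) = U(A) − 1», `|U(κA'(Γ)) − 1| ≤ ℓ|κA'(Γ)|`). [cite: Balaban1983RegularityDecay, p. 580] -/
theorem pertF_site (hℓ : 0 ≤ ℓ)
    (hLip : ∀ t (v : ι → ℝ), ((F.U t - 1) *ᵥ v) ⬝ᵥ ((F.U t - 1) *ᵥ v) ≤ (ℓ * t) ^ 2 * (v ⬝ᵥ v))
    (hn : 1 ≤ n) (hτ0 : 0 ≤ τ)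
    (hτ : ∀ y x, blkWt n M (fun i => n * M i) y x ≠ 0 → |κ * lsum A' (emb y) (Γ y x)| ≤ τ)
    (u : ↥(boxDom fun i => n * M i) × ι → ℝ) (y : ↥(boxDom M)) :
    siteNorm (fld (pertF (blkWt n M fun i => n * M i) (contourTrans (fieldLink F κ A') emb Γ)
        (contourTrans (fieldLink F κ A₀) emb Γ) *ᵥ u) y) ≤ (n : ℝ) ^ (d + 1) * (ℓ * τ) * supN u := by
  rw [pertF, fld_avgOp_mulVec]
  refine (siteNorm_sum_le _ _).trans ?_
  have hterm : ∀ x, siteNorm (blkWt n M (fun i => n * M i) y x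
      • (kmul (pertT (contourTrans (fieldLink F κ A') emb Γ)) (contourTrans (fieldLink F κ A₀) emb Γ) y x
          *ᵥ fld u x)) ≤ blkWt n M (fun i => n * M i) y x * (ℓ * τ * supN u) := by
    intro x
    rw [siteNorm_smul, abs_of_nonneg (blkWt_nonneg n M _ y x)]
    by_cases hq : blkWt n M (fun i => n * M i) y x = 0
    · rw [hq, zero_mul, zero_mul]
    refine mul_le_mul_of_nonneg_left ?_ (blkWt_nonneg n M _ y x)
    rw [kmul_apply, pertT, ← mulVec_mulVec, contourTrans_fieldLink, contourTrans_fieldLink]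
    refine (siteNorm_flow_sub_one_le F hℓ hLip _ _).trans ?_
    rw [siteNorm_flow]
    exact mul_le_mul (mul_le_mul_of_nonneg_left (hτ y x hq) hℓ) (le_supN u x) (siteNorm_nonneg _)
      (mul_nonneg hℓ hτ0)
  refine (sum_le_sum fun x _ => hterm x).trans ?_
  rw [← sum_mul]
  have h0 : 0 ≤ ℓ * τ * supN u := mul_nonneg (mul_nonneg hℓ hτ0) (supN_nonneg u)
  calc (∑ x, blkWt n M (fun i => n * M i) y x) * (ℓ * τ * supN u) ≤ (n : ℝ) ^ (d + 1) * (ℓ * τ * supN u) :=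
        mul_le_mul_of_nonneg_right (sum_blkWt_row hn M y) h0
    _ = (n : ℝ) ^ (d + 1) * (ℓ * τ) * supN u := by ring

/-- **`|(Q_k(A₀)ᵀw)(x)| ≤ ‖w‖_∞`** (each fine point lies in one block).
[cite: Balaban1983RegularityDecay, p. 572 (1.5)] -/
theorem avgT_site (w : ↥(boxDom M) × ι → ℝ) (x : ↥(boxDom fun i => n * M i)) :
    siteNorm (fld ((avgOp (blkWt n M fun i => n * M i) (contourTrans (fieldLink F κ A₀) emb Γ))ᵀ *ᵥ w) x)
      ≤ supN w := by
  rw [fld_avgOp_transpose_mulVec]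
  refine (siteNorm_sum_le _ _).trans ?_
  have hterm : ∀ y, siteNorm (blkWt n M (fun i => n * M i) y x
      • ((contourTrans (fieldLink F κ A₀) emb Γ y x)ᵀ *ᵥ fld w y)) ≤ blkWt n M (fun i => n * M i) y x * supN w := by
    intro y
    rw [siteNorm_smul, abs_of_nonneg (blkWt_nonneg n M _ y x), contourTrans_fieldLink, F.transpose_eq,
      siteNorm_flow]
    exact mul_le_mul_of_nonneg_left (le_supN w y) (blkWt_nonneg n M _ y x)
  refine (sum_le_sum fun y _ => hterm y).trans ?_
  rw [← sum_mul]
  have h1 := sum_blkWt_col n M (fun i => n * M i) x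
  nlinarith [supN_nonneg w]

/-- **`|(F₂ᵀw)(x)| ≤ ℓτ‖w‖_∞`**. [cite: Balaban1983RegularityDecay, p. 580] -/
theorem pertFT_site (hℓ : 0 ≤ ℓ)
    (hLip : ∀ t (v : ι → ℝ), ((F.U t - 1) *ᵥ v) ⬝ᵥ ((F.U t - 1) *ᵥ v) ≤ (ℓ * t) ^ 2 * (v ⬝ᵥ v))
    (hτ0 : 0 ≤ τ) (hτ : ∀ y x, blkWt n M (fun i => n * M i) y x ≠ 0 → |κ * lsum A' (emb y) (Γ y x)| ≤ τ)
    (w : ↥(boxDom M) × ι → ℝ) (x : ↥(boxDom fun i => n * M i)) :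
    siteNorm (fld ((pertF (blkWt n M fun i => n * M i) (contourTrans (fieldLink F κ A') emb Γ)
        (contourTrans (fieldLink F κ A₀) emb Γ))ᵀ *ᵥ w) x) ≤ ℓ * τ * supN w := by
  rw [pertF, fld_avgOp_transpose_mulVec]
  refine (siteNorm_sum_le _ _).trans ?_
  have hterm : ∀ y, siteNorm (blkWt n M (fun i => n * M i) y x
      • ((kmul (pertT (contourTrans (fieldLink F κ A') emb Γ)) (contourTrans (fieldLink F κ A₀) emb Γ) y x)ᵀ
          *ᵥ fld w y)) ≤ blkWt n M (fun i => n * M i) y x * (ℓ * τ * supN w) := by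
    intro y
    rw [siteNorm_smul, abs_of_nonneg (blkWt_nonneg n M _ y x)]
    by_cases hq : blkWt n M (fun i => n * M i) y x = 0
    · rw [hq, zero_mul, zero_mul]
    refine mul_le_mul_of_nonneg_left ?_ (blkWt_nonneg n M _ y x)
    rw [kmul_apply, pertT, Matrix.transpose_mul, ← mulVec_mulVec, contourTrans_fieldLink, contourTrans_fieldLink,
      F.transpose_eq, siteNorm_flow, Matrix.transpose_sub, Matrix.transpose_one, F.transpose_eq]
    refine (siteNorm_flow_sub_one_le F hℓ hLip _ _).trans ?_
    rw [abs_neg]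
    exact mul_le_mul (mul_le_mul_of_nonneg_left (hτ y x hq) hℓ) (le_supN w y) (siteNorm_nonneg _)
      (mul_nonneg hℓ hτ0)
  refine (sum_le_sum fun y _ => hterm y).trans ?_
  rw [← sum_mul]
  have h1 := sum_blkWt_col n M (fun i => n * M i) x
  have h2 : 0 ≤ ℓ * τ * supN w := mul_nonneg (mul_nonneg hℓ hτ0) (supN_nonneg w)
  nlinarith

/-- **THE `a`-TERMS ARE ZEROTH-ORDER SMALL**: `‖a(F₂^*Q₀ + Q₀^*F₂ + F₂^*F₂)u‖_∞ ≤ |a|·n^{d+1}·ℓτ(2 + ℓτ)·‖u‖_∞`;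
with [B4]'s coefficient `a = a_k·n^{-(d+1)}` this is `a_kℓτ(2+ℓτ)‖u‖_∞` (`aterm_supN_le'`).
[cite: Balaban1983RegularityDecay, p. 581 (2.32); p. 579 (2.24)] -/
theorem aterm_supN_le (hℓ : 0 ≤ ℓ)
    (hLip : ∀ t (v : ι → ℝ), ((F.U t - 1) *ᵥ v) ⬝ᵥ ((F.U t - 1) *ᵥ v) ≤ (ℓ * t) ^ 2 * (v ⬝ᵥ v))
    (hn : 1 ≤ n) (hτ0 : 0 ≤ τ)
    (hτ : ∀ y x, blkWt n M (fun i => n * M i) y x ≠ 0 → |κ * lsum A' (emb y) (Γ y x)| ≤ τ) (a : ℝ)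
    (u : ↥(boxDom fun i => n * M i) × ι → ℝ) :
    supN ((a • ((pertF (blkWt n M fun i => n * M i) (contourTrans (fieldLink F κ A') emb Γ)
          (contourTrans (fieldLink F κ A₀) emb Γ))ᵀ
        * avgOp (blkWt n M fun i => n * M i) (contourTrans (fieldLink F κ A₀) emb Γ)
      + (avgOp (blkWt n M fun i => n * M i) (contourTrans (fieldLink F κ A₀) emb Γ))ᵀ
        * pertF (blkWt n M fun i => n * M i) (contourTrans (fieldLink F κ A') emb Γ)
          (contourTrans (fieldLink F κ A₀) emb Γ)
      + (pertF (blkWt n M fun i => n * M i) (contourTrans (fieldLink F κ A') emb Γ)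
          (contourTrans (fieldLink F κ A₀) emb Γ))ᵀ
        * pertF (blkWt n M fun i => n * M i) (contourTrans (fieldLink F κ A') emb Γ)
          (contourTrans (fieldLink F κ A₀) emb Γ))) *ᵥ u)
      ≤ |a| * ((n : ℝ) ^ (d + 1) * (ℓ * τ * (2 + ℓ * τ))) * supN u := by
  set Q := avgOp (blkWt n M fun i => n * M i) (contourTrans (fieldLink F κ A₀) emb Γ) with hQ
  set P := pertF (blkWt n M fun i => n * M i) (contourTrans (fieldLink F κ A') emb Γ)
    (contourTrans (fieldLink F κ A₀) emb Γ) with hP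
  have hu := supN_nonneg u
  have h1 : supN ((Pᵀ * Q) *ᵥ u) ≤ ℓ * τ * ((n : ℝ) ^ (d + 1) * supN u) := by
    rw [← mulVec_mulVec]
    refine supN_le (by positivity) fun x => (pertFT_site F κ M emb Γ A₀ A' hℓ hLip hτ0 hτ _ x).trans ?_
    exact mul_le_mul_of_nonneg_left (supN_le (by positivity) fun y => avg_site F κ M emb Γ A₀ hn u y)
      (mul_nonneg hℓ hτ0)
  have h2 : supN ((Qᵀ * P) *ᵥ u) ≤ (n : ℝ) ^ (d + 1) * (ℓ * τ) * supN u := by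
    rw [← mulVec_mulVec]
    refine supN_le (by positivity) fun x => (avgT_site F κ M emb Γ A₀ _ x).trans ?_
    exact supN_le (by positivity) fun y => pertF_site F κ M emb Γ A₀ A' hℓ hLip hn hτ0 hτ u y
  have h3 : supN ((Pᵀ * P) *ᵥ u) ≤ ℓ * τ * ((n : ℝ) ^ (d + 1) * (ℓ * τ) * supN u) := by
    rw [← mulVec_mulVec]
    refine supN_le (by positivity) fun x => (pertFT_site F κ M emb Γ A₀ A' hℓ hLip hτ0 hτ _ x).trans ?_
    exact mul_le_mul_of_nonneg_left (supN_le (by positivity) fun y =>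
      pertF_site F κ M emb Γ A₀ A' hℓ hLip hn hτ0 hτ u y) (mul_nonneg hℓ hτ0)
  rw [smul_mulVec]
  refine (supN_smul_le a _).trans ?_
  rw [mul_assoc]
  refine mul_le_mul_of_nonneg_left ?_ (abs_nonneg a)
  rw [add_mulVec, add_mulVec]
  refine ((supN_add_le _ _).trans (add_le_add ((supN_add_le _ _).trans (add_le_add h1 h2)) h3)).trans ?_
  have : ℓ * τ * ((n : ℝ) ^ (d + 1) * supN u) + (n : ℝ) ^ (d + 1) * (ℓ * τ) * supN u
      + ℓ * τ * ((n : ℝ) ^ (d + 1) * (ℓ * τ) * supN u) = (n : ℝ) ^ (d + 1) * (ℓ * τ * (2 + ℓ * τ)) * supN u := by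
    ring
  rw [this]

/-- the same with [B4]'s coefficient `a = a_k·n^{-(d+1)}`, `a_k ≥ 0`: `≤ a_kℓτ(2+ℓτ)‖u‖_∞`.
[cite: Balaban1983RegularityDecay, p. 581 (2.32)] -/
theorem aterm_supN_le' (hℓ : 0 ≤ ℓ)
    (hLip : ∀ t (v : ι → ℝ), ((F.U t - 1) *ᵥ v) ⬝ᵥ ((F.U t - 1) *ᵥ v) ≤ (ℓ * t) ^ 2 * (v ⬝ᵥ v))
    (hn : 1 ≤ n) (hτ0 : 0 ≤ τ)
    (hτ : ∀ y x, blkWt n M (fun i => n * M i) y x ≠ 0 → |κ * lsum A' (emb y) (Γ y x)| ≤ τ) {ak : ℝ}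
    (hak : 0 ≤ ak) (u : ↥(boxDom fun i => n * M i) × ι → ℝ) :
    supN (((ak * ((n : ℝ) ^ (d + 1))⁻¹) • ((pertF (blkWt n M fun i => n * M i)
          (contourTrans (fieldLink F κ A') emb Γ) (contourTrans (fieldLink F κ A₀) emb Γ))ᵀ
        * avgOp (blkWt n M fun i => n * M i) (contourTrans (fieldLink F κ A₀) emb Γ)
      + (avgOp (blkWt n M fun i => n * M i) (contourTrans (fieldLink F κ A₀) emb Γ))ᵀ
        * pertF (blkWt n M fun i => n * M i) (contourTrans (fieldLink F κ A') emb Γ)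
          (contourTrans (fieldLink F κ A₀) emb Γ)
      + (pertF (blkWt n M fun i => n * M i) (contourTrans (fieldLink F κ A') emb Γ)
          (contourTrans (fieldLink F κ A₀) emb Γ))ᵀ
        * pertF (blkWt n M fun i => n * M i) (contourTrans (fieldLink F κ A') emb Γ)
          (contourTrans (fieldLink F κ A₀) emb Γ))) *ᵥ u)
      ≤ ak * (ℓ * τ * (2 + ℓ * τ)) * supN u := by
  have hn0 : (0 : ℝ) < (n : ℝ) ^ (d + 1) := by positivity
  refine (aterm_supN_le F κ M emb Γ A₀ A' hℓ hLip hn hτ0 hτ _ u).trans (le_of_eq ?_)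
  rw [abs_of_nonneg (by positivity), mul_assoc ak, ← mul_assoc (((n : ℝ) ^ (d + 1))⁻¹), inv_mul_cancel₀ hn0.ne',
    one_mul]

end ATerms

/-! ## §6 `V` IS FIRST-ORDER SMALL UP TO ITS DIVERGENCE-FORM CROSS TERM; LEMMA 2.2 (2.17)_∞ FOR `G_k(□,Ã)` ONE
PIECE AWAY -/

section Assembly

variable {d : ℕ}

/-- **`−V = vOp = C + Cᵀ + F₁^*F₁ + a(F₂^*Q₀ + Q₀^*F₂ + F₂^*F₂)` IS FIRST-ORDER SMALL IN `‖·‖_∞` RELATIVE TO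
`(D^η_{A₀,μ})_μ`, GIVEN THAT ITS DIVERGENCE-FORM CROSS TERM `C` IS**: on the fine box `Π[0,nM_μ)` with [B4]'s
weights, for an antisymmetric background bond function `A₀` and a perturbation `A'` with `|κA'_b| ≤ θ/n` on
nearest-neighbour bonds and `|κA'(Γ_{y,x})| ≤ τ` along the block contours: `FirstOrderSmall(C, ε_C) ⇒
FirstOrderSmall(V, ε_C + (d+1)ℓθ + (d+1)ℓ²θ² + a_kℓτ(2+ℓτ))`. [cite: Balaban1983RegularityDecay, p. 581 (2.32)] -/
theorem firstOrderSmall_vOp (F : OrthFlow ι) {ℓ : ℝ} (hℓ : 0 ≤ ℓ)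
    (hLip : ∀ t (v : ι → ℝ), ((F.U t - 1) *ᵥ v) ⬝ᵥ ((F.U t - 1) *ᵥ v) ≤ (ℓ * t) ^ 2 * (v ⬝ᵥ v))
    (κ : ℝ) {n : ℕ} (hn : 1 ≤ n) (M : Fin (d + 1) → ℕ) (emb : ↥(boxDom M) → ↥(boxDom fun i => n * M i))
    (Γ : ↥(boxDom M) → ↥(boxDom fun i => n * M i) → List ↥(boxDom fun i => n * M i))
    (A₀ : ↥(boxDom fun i => n * M i) → ↥(boxDom fun i => n * M i) → ℝ) (hanti : ∀ x y, A₀ y x = -A₀ x y)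
    {A' : ↥(boxDom fun i => n * M i) → ↥(boxDom fun i => n * M i) → ℝ} {θ τ ak εC : ℝ} (hθ : 0 ≤ θ)
    (hA' : ∀ x y, y.1 ∈ nbrs x.1 → |κ * A' x y| ≤ θ / n) (hτ0 : 0 ≤ τ)
    (hτ : ∀ y x, blkWt n M (fun i => n * M i) y x ≠ 0 → |κ * lsum A' (emb y) (Γ y x)| ≤ τ) (hak : 0 ≤ ak)
    (hC : FirstOrderSmall supN
      (crossOp (boxWt n fun i => n * M i) (fieldLink F κ A₀) (pertE (fieldLink F κ A')))
      (covDeriv n (boxDom fun i => n * M i) (fieldLink F κ A₀)) εC) :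
    FirstOrderSmall supN
      (-vOp (boxWt n fun i => n * M i) (ak * ((n : ℝ) ^ (d + 1))⁻¹) (blkWt n M fun i => n * M i)
        (fieldLink F κ A') (fieldLink F κ A₀) (contourTrans (fieldLink F κ A') emb Γ)
        (contourTrans (fieldLink F κ A₀) emb Γ))
      (covDeriv n (boxDom fun i => n * M i) (fieldLink F κ A₀))
      (εC + ((d : ℝ) + 1) * ℓ * θ + ((d : ℝ) + 1) * ℓ ^ 2 * θ ^ 2 + ak * (ℓ * τ * (2 + ℓ * τ))) := by
  refine firstOrderSmall_neg ?_
  rw [vOp]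
  exact firstOrderSmall_add (firstOrderSmall_add (firstOrderSmall_add hC
    (firstOrderSmall_crossT F hℓ hLip κ hn _ A₀ hanti hθ hA')) (firstOrderSmall_quad F hℓ hLip κ hn _ hθ hA' _))
    (firstOrderSmall_of_zeroth _ (by positivity) fun u =>
      aterm_supN_le' F κ M emb Γ A₀ A' hℓ hLip hn hτ0 hτ hak u)

open Literature.MathematicalPhysics.QuantumFieldTheory.Balaban1983to89.B4GaugeCovariance (pathEnd)
open Literature.MathematicalPhysics.QuantumFieldTheory.Balaban1983to89.B4Lemma22ReduceZero (Box greenA opA pertV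
  derivA derivA0)
open Literature.MathematicalPhysics.QuantumFieldTheory.Balaban1983to89.B4Lemma22ReduceDeriv
  (lemma22_17_sup_field_regular)

/-- **[B4]'s `V` OF (2.24)/(2.31) (`B4Lemma22ReduceZero.pertV`) IS FIRST-ORDER SMALL IN `‖·‖_∞` RELATIVE TO
`D^η_{A₀}`, UP TO ITS DIVERGENCE-FORM CROSS TERM** — the typed remaining input of
`B4Lemma22ReduceZero.lemma22_17_sup_field` reduced to the single piece `C = Σ c·D_{A₀}ᵀEπ`
(«D^{η*}_{A₀}F_{1,k}(−A')», whose smallness needs a summation by parts and «Ã is constant in a neighbourhood of ∂□»).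
[cite: Balaban1983RegularityDecay, p. 581 (2.32); p. 579–580 (2.24)–(2.25)] -/
theorem firstOrderSmall_pertV (F : OrthFlow ι) {ℓ₁ : ℝ} (hℓ₁ : 0 ≤ ℓ₁)
    (hLip : ∀ t (v : ι → ℝ), ((F.U t - 1) *ᵥ v) ⬝ᵥ ((F.U t - 1) *ᵥ v) ≤ (ℓ₁ * t) ^ 2 * (v ⬝ᵥ v))
    (κ : ℝ) {ℓ k : ℕ} (hℓ : 1 ≤ ℓ) (hk : 1 ≤ k) {a : ℝ} (ha : 0 < a) (M : Fin (d + 1) → ℕ)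
    (emb : ↥(boxDom M) → ↥(Box d ℓ k M)) (Γ : ↥(boxDom M) → ↥(Box d ℓ k M) → List ↥(Box d ℓ k M))
    (A₀ : Fin (d + 1) → ℝ) {A' : ↥(Box d ℓ k M) → ↥(Box d ℓ k M) → ℝ} {θ τ εC : ℝ} (hθ : 0 ≤ θ)
    (hA' : ∀ x y : ↥(Box d ℓ k M), y.1 ∈ nbrs x.1 → |κ * A' x y| ≤ θ / ((ℓ + 1) ^ k : ℕ)) (hτ0 : 0 ≤ τ)
    (hτ : ∀ y x, blkWt ((ℓ + 1) ^ k) M (fun i => (ℓ + 1) ^ k * M i) y x ≠ 0 →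
      |κ * lsum A' (emb y) (Γ y x)| ≤ τ)
    (hC : FirstOrderSmall supN
      (crossOp (boxWt ((ℓ + 1) ^ k) fun i => (ℓ + 1) ^ k * M i) (fieldLink F κ (constBond A₀ Subtype.val))
        (pertE (fieldLink F κ A'))) (derivA0 d F κ ℓ k M A₀) εC) :
    FirstOrderSmall supN (pertV d F κ ℓ k a M emb Γ A₀ A') (derivA0 d F κ ℓ k M A₀)
      (εC + ((d : ℝ) + 1) * ℓ₁ * θ + ((d : ℝ) + 1) * ℓ₁ ^ 2 * θ ^ 2
        + B1.aSeq a ((ℓ : ℝ) + 1) k * (ℓ₁ * τ * (2 + ℓ₁ * τ))) := by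
  have hn : 1 ≤ (ℓ + 1) ^ k := Nat.one_le_pow _ _ (Nat.succ_pos ℓ)
  have hL : (1 : ℝ) < (ℓ : ℝ) + 1 := by
    have : (1 : ℝ) ≤ ℓ := by exact_mod_cast hℓ
    linarith
  have hak : 0 ≤ B1.aSeq a ((ℓ : ℝ) + 1) k := (B1.aSeq_pos ha hL hk).le
  have key := firstOrderSmall_vOp F hℓ₁ hLip κ hn M emb Γ (constBond A₀ Subtype.val)
    (constBond_antisymm A₀ Subtype.val) hθ hA' hτ0 hτ hak hC
  exact key

/-- **LEMMA 2.2 (2.17), `q = p = ∞`, `n = 0,1` (BOTH DERIVATIVE CONVENTIONS) FOR [B4]'s `G_k(□,Ã)` ON A FINE BOX,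
ONE PIECE AWAY** — `B4Lemma22ReduceDeriv.lemma22_17_sup_field_regular` with the first-order smallness of `V`
DISCHARGED UP TO ITS DIVERGENCE-FORM CROSS TERM: there is `c > 0` (the constant-configuration constant, uniform on the
window `a ∈ [amin, aplus]`, `m² ∈ [0, m2plus]`, all boxes, all contour systems, all `A₀`) such that IF `H(□,Ã)` is
invertible, `|κA'_b| ≤ θ/n` on nearest-neighbour bonds, `|κA'(Γ_{y,x})| ≤ τ` on the block contours, the cross term
`C` is first-order small with constant `ε_C`, and
`(d+2)c(ε_C + (d+1)ℓθ + (d+1)ℓ²θ² + a_kℓτ(2+ℓτ)) ≤ 1/2`, THEN `‖GΦ‖_∞ + Σ_μ‖D^η_{A₀,μ}GΦ‖_∞ ≤ 2(d+2)c‖Φ‖_∞` and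
`‖D^η_{Ã,μ}GΦ‖_∞ ≤ (1+ℓθ)2(d+2)c‖Φ‖_∞`, `G = G_k(□,Ã)`.
[cite: Balaban1983RegularityDecay, Lemma 2.2 (2.17) p. 578; proof pp. 579–581 (2.24)–(2.25), (2.31)–(2.33)] -/
theorem lemma22_17_sup_cross (F : OrthFlow ι) {ℓ₁ : ℝ} (hℓ₁ : 0 ≤ ℓ₁)
    (hLip : ∀ t (v : ι → ℝ), ((F.U t - 1) *ᵥ v) ⬝ᵥ ((F.U t - 1) *ᵥ v) ≤ (ℓ₁ * t) ^ 2 * (v ⬝ᵥ v))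
    (κ : ℝ) (d ℓ : ℕ) (hℓ : 1 ≤ ℓ) (amin aplus m2plus : ℝ) (ha : 0 < amin) :
    ∃ c : ℝ, 0 < c ∧ ∀ (k : ℕ), 1 ≤ k → ∀ (a m2 : ℝ), amin ≤ a → a ≤ aplus → 0 ≤ m2 → m2 ≤ m2plus →
      ∀ (M : Fin (d + 1) → ℕ), (∀ i, 1 ≤ M i) →
      ∀ (emb : ↥(boxDom M) → ↥(Box d ℓ k M)) (Γ : ↥(boxDom M) → ↥(Box d ℓ k M) → List ↥(Box d ℓ k M)),
        (∀ y x, blkWt ((ℓ + 1) ^ k) M (fun i => (ℓ + 1) ^ k * M i) y x ≠ 0 → pathEnd (emb y) (Γ y x) = x) →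
      ∀ (A₀ : Fin (d + 1) → ℝ) (A' : ↥(Box d ℓ k M) → ↥(Box d ℓ k M) → ℝ) (εC θ τ : ℝ),
        IsUnit (opA d F κ ℓ k a m2 M emb Γ (constBond A₀ Subtype.val + A')).det →
        0 ≤ θ → (∀ x y : ↥(Box d ℓ k M), y.1 ∈ nbrs x.1 → |κ * A' x y| ≤ θ / ((ℓ + 1) ^ k : ℕ)) →
        0 ≤ τ → (∀ y x, blkWt ((ℓ + 1) ^ k) M (fun i => (ℓ + 1) ^ k * M i) y x ≠ 0 →
          |κ * lsum A' (emb y) (Γ y x)| ≤ τ) →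
        FirstOrderSmall supN
          (crossOp (boxWt ((ℓ + 1) ^ k) fun i => (ℓ + 1) ^ k * M i) (fieldLink F κ (constBond A₀ Subtype.val))
            (pertE (fieldLink F κ A'))) (derivA0 d F κ ℓ k M A₀) εC →
        ((d : ℝ) + 2) * c * (εC + ((d : ℝ) + 1) * ℓ₁ * θ + ((d : ℝ) + 1) * ℓ₁ ^ 2 * θ ^ 2
          + B1.aSeq a ((ℓ : ℝ) + 1) k * (ℓ₁ * τ * (2 + ℓ₁ * τ))) ≤ 1 / 2 →
        ∀ Φ : ↥(Box d ℓ k M) × ι → ℝ,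
          supN (greenA d F κ ℓ k a m2 M emb Γ (constBond A₀ Subtype.val + A') *ᵥ Φ)
              + ∑ μ, supN (derivA0 d F κ ℓ k M A₀ μ
                  *ᵥ (greenA d F κ ℓ k a m2 M emb Γ (constBond A₀ Subtype.val + A') *ᵥ Φ))
              ≤ 2 * (((d : ℝ) + 2) * c) * supN Φ ∧
          ∀ μ : Fin (d + 1),
            supN (derivA d F κ ℓ k M (constBond A₀ Subtype.val + A') μ
                *ᵥ (greenA d F κ ℓ k a m2 M emb Γ (constBond A₀ Subtype.val + A') *ᵥ Φ))
              ≤ (1 + ℓ₁ * θ) * (2 * (((d : ℝ) + 2) * c)) * supN Φ := by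
  obtain ⟨c, hc, h⟩ := lemma22_17_sup_field_regular F hℓ₁ hLip κ d ℓ hℓ amin aplus m2plus ha
  refine ⟨c, hc, ?_⟩
  intro k hk a m2 e1' e2 e3 e4 M hM emb Γ hend A₀ A' εC θ τ hunit hθ hA' hτ0 hτ hC hsm Φ
  exact h k hk a m2 e1' e2 e3 e4 M hM emb Γ hend A₀ A' _ θ hunit
    (firstOrderSmall_pertV F hℓ₁ hLip κ hℓ hk (lt_of_lt_of_le ha e1') M emb Γ A₀ hθ hA' hτ0 hτ hC) hsm hθ hA' Φ

end Assembly

end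

end Literature.MathematicalPhysics.QuantumFieldTheory.Balaban1983to89.B4Lemma22PertVSup
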